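import Mathlib
import Literature.Analysis.FluidPDE.BurgersVortexSteady
import Summits.NavierStokesRegularity.NavierStokesRegularity.Theorems.FilamentSkeletonRssDefectColumnGateDipoleSector

/-!
# Route `FilamentSkeletonRss` · crux `TransverseReduction1AG` (stmt-NavierStokesRegularity-27853) · line `defect_column_gate_1AG` —
# the TRANSLATION MODE of the column is an exact eigenfunction of the S2a operator with eigenvalue `γ/2`, for EVERY circulation `Rc`

Helper file (theorems only, `--supports stmt-NavierStokesRegularity-27853 --as helper`; LEAD of 27853, lane ns-filament-21221-p1 g11).  On the dipole
sector (`colForceVort_dip`, `Theorems/…DipoleSector.lean`) take `φ(q) = burgersPhi(γq/4)` — so that `Ψ = y₀φ(q)` is, up to the factor `−γRc/(8π)`, the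
stream function `∂₀Ψ_S` of the infinitesimal TRANSLATION of the Gaussian column along `e₀`, and `curl W = y₀·γe^{−γq/4}·e₃ ∝ ∂₀Ω_S` (`dipole_g_eq`).
Then the two `Rc`-terms of the S2a operator — rotation of the pattern by the column, `−c(q)g(q)`, and the Biot–Savart reaction of the displaced column,
`(γ/2)ζ(q)φ(q)` — CANCEL IDENTICALLY (`c·g = (γ/2)ζφ`, both equal `γ²Rc/(8π)·φ(t)e^{−t}`, `t = γq/4`), and the Fokker–Planck part returns `(γ/2)·g`:
**`colForceVort B α γ Rc e₃ W = (γ/2)·curl W`** (`colForceVort_translationMode`) for the symmetric column `B = diag(−γ/2, −γ/2, 3/2+γ)`, every rate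
`α` and every circulation `Rc`.  This kernel-checks the structural fact used in the lead's S2a-loc analysis (memo S2A-LOC-ANALYSIS-27853-g11.md §3(d)):
the displacement modes sit EXACTLY at `Re μ = γ/2`, uniformly in `Rc` (Gallay–Wayne's `λ₁ = 1/2` in their scaling); they are dipoles (`Ψ ~ y₀/q`), hence
outside the compactly supported class of S2a-loc, and mark the bottom of the zero-mass sectional spectrum that any S2a-loc kill would have to undercut.
HONEST FRAMING: an identity about the MODEL operator of a hypothetical blow-up route (MODEL rung, negative side); no stub is proved or refuted here;
nothing here bears on Navier–Stokes regularity.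
-/

set_option linter.dupNamespace false

noncomputable section

namespace Summit.NavierStokesRegularity.NavierStokesRegularity.Theorems.DefectColumnGate

open scoped BigOperators Topology InnerProductSpace Laplacian ContDiff
open Set Function
open Literature.Analysis.FluidPDE
open Literature.Analysis.FluidPDE.StrainedAzimuthal
open Summit.NavierStokesRegularity.NavierStokesRegularity.Theorems.KelvinGate

/-! ## 1. The rescaled profile `φ(q) = burgersPhi(γq/4)` and its vorticity profile `g = γ e^{−γq/4}` -/

/-- `φ(q) = burgersPhi(γq/4)` is smooth. -/
theorem contDiff_dipolePhi (γ : ℝ) {n : WithTop ℕ∞} : ContDiff ℝ n (fun q : ℝ => burgersPhi (γ * q / 4)) :=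
  contDiff_burgersPhi.comp ((contDiff_const.mul contDiff_id).div_const 4)

/-- `φ′(q) = (γ/4)·burgersPhi′(γq/4)`. -/
theorem deriv_dipolePhi (γ : ℝ) :
    deriv (fun q : ℝ => burgersPhi (γ * q / 4)) = fun q => deriv burgersPhi (γ * q / 4) * (γ / 4) := by
  funext q
  have hlin : HasDerivAt (fun q : ℝ => γ * q / 4) (γ / 4) q := by
    simpa using ((hasDerivAt_id' q).const_mul γ).div_const 4
  exact ((hasDerivAt_burgersPhi (γ * q / 4)).comp q hlin).deriv

/-- `φ″(q) = (γ/4)²·burgersPhi″(γq/4)`. -/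
theorem deriv_deriv_dipolePhi (γ : ℝ) :
    deriv (deriv (fun q : ℝ => burgersPhi (γ * q / 4))) = fun q => deriv (deriv burgersPhi) (γ * q / 4) * (γ / 4) * (γ / 4) := by
  rw [deriv_dipolePhi]
  funext q
  have hlin : HasDerivAt (fun q : ℝ => γ * q / 4) (γ / 4) q := by
    simpa using ((hasDerivAt_id' q).const_mul γ).div_const 4
  exact (((hasDerivAt_deriv_burgersPhi (γ * q / 4)).comp q hlin).mul_const (γ / 4)).deriv

/-- **The vorticity profile of the dipole mode is the Gaussian**: `g(q) := −(4qφ″(q) + 8φ′(q)) = γ·e^{−γq/4}` (from `2φ′(t) + tφ″(t) = −e^{−t}`). -/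
theorem dipole_g_eq (γ q : ℝ) :
    -(4 * q * deriv (deriv (fun q : ℝ => burgersPhi (γ * q / 4))) q + 8 * deriv (fun q : ℝ => burgersPhi (γ * q / 4)) q)
      = γ * Real.exp (-(γ * q / 4)) := by
  rw [deriv_deriv_dipolePhi, deriv_dipolePhi]
  simp only
  have h := two_mul_deriv_add_mul_deriv_deriv_burgersPhi (γ * q / 4)
  have e : 4 * q * (deriv (deriv burgersPhi) (γ * q / 4) * (γ / 4) * (γ / 4)) + 8 * (deriv burgersPhi (γ * q / 4) * (γ / 4))
      = γ * (2 * deriv burgersPhi (γ * q / 4) + γ * q / 4 * deriv (deriv burgersPhi) (γ * q / 4)) := by ring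
  rw [e, h]; ring

/-! ## 2. The eigen-identity -/

/-- **THE TRANSLATION MODE IS AN EXACT EIGENFUNCTION WITH EIGENVALUE `γ/2`, FOR EVERY `Rc`.**  `B = diag(−γ/2, −γ/2, 3/2+γ)`, any `α`, any `Rc`,
`Ψ(y) = y₀·burgersPhi(γ(y₀²+y₁²)/4)`, `W = ∇Ψ × e₃`:  `colForceVort B α γ Rc e₃ W (y) = (γ/2)·curl W (y)`. -/
theorem colForceVort_translationMode {B : EuclideanSpace ℝ (Fin 3) →L[ℝ] EuclideanSpace ℝ (Fin 3)} {γ α Rc : ℝ}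
    (hB0 : B (EuclideanSpace.single 0 1) = (-(γ / 2)) • EuclideanSpace.single 0 1)
    (hB1 : B (EuclideanSpace.single 1 1) = (-(γ / 2)) • EuclideanSpace.single 1 1)
    (hB2 : B (EuclideanSpace.single 2 1) = (3 / 2 + γ) • EuclideanSpace.single 2 1) (y : EuclideanSpace ℝ (Fin 3)) :
    colForceVort B α γ Rc (EuclideanSpace.single 2 1)
        (fun z => cross (gradient (fun y : EuclideanSpace ℝ (Fin 3) => y 0 * burgersPhi (γ * (y 0 ^ 2 + y 1 ^ 2) / 4)) z)
          (EuclideanSpace.single 2 1)) y =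
      (γ / 2) • curl (fun z => cross (gradient (fun y : EuclideanSpace ℝ (Fin 3) => y 0 * burgersPhi (γ * (y 0 ^ 2 + y 1 ^ 2) / 4)) z)
          (EuclideanSpace.single 2 1)) y := by
  -- the profile `φ`, its vorticity profile `g`, in the shape `colForceVort_dip` wants
  set φ : ℝ → ℝ := fun q => burgersPhi (γ * q / 4) with hφdef
  have hΨ : (fun y : EuclideanSpace ℝ (Fin 3) => y 0 * burgersPhi (γ * (y 0 ^ 2 + y 1 ^ 2) / 4))
      = fun y : EuclideanSpace ℝ (Fin 3) => y 0 * φ (y 0 ^ 2 + y 1 ^ 2) := rfl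
  have hφC : ContDiff ℝ 4 φ := contDiff_dipolePhi γ
  have hφ2 : ContDiff ℝ 2 φ := contDiff_dipolePhi γ
  have hφ1 : Differentiable ℝ φ := hφC.differentiable (by norm_num)
  set g : ℝ → ℝ := fun u => -(4 * u * deriv (deriv φ) u + 8 * deriv φ u) with hgdef
  have hg : ∀ u, g u = -(4 * u * deriv (deriv φ) u + 8 * deriv φ u) := fun u => rfl
  have hgE : ∀ u, g u = γ * Real.exp (-(γ * u / 4)) := fun u => by rw [hg]; exact dipole_g_eq γ u
  have hgfun : g = fun u => γ * Real.exp (-(γ * u / 4)) := funext hgE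
  -- derivatives of `g`
  have hexp : ∀ u, HasDerivAt (fun u : ℝ => Real.exp (-(γ * u / 4))) (Real.exp (-(γ * u / 4)) * (-(γ / 4))) u := fun u => by
    have hfun : (fun u : ℝ => -(γ * u / 4)) = fun u => (-(γ / 4)) * u := by funext u; ring
    have hlin : HasDerivAt (fun u : ℝ => -(γ * u / 4)) (-(γ / 4)) u := by
      rw [hfun]; simpa using (hasDerivAt_id' u).const_mul (-(γ / 4))
    exact hlin.exp
  have hg' : deriv g = fun u => -(γ ^ 2 / 4) * Real.exp (-(γ * u / 4)) := by
    rw [hgfun]; funext u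
    exact ((hexp u).const_mul γ).deriv.trans (by ring)
  have hg'' : deriv (deriv g) = fun u => (γ ^ 3 / 16) * Real.exp (-(γ * u / 4)) := by
    rw [hg']; funext u
    exact ((hexp u).const_mul (-(γ ^ 2 / 4))).deriv.trans (by ring)
  -- the vorticity of the mode
  have hax : ∀ z, fderiv ℝ (fun y : EuclideanSpace ℝ (Fin 3) => y 0 * φ (y 0 ^ 2 + y 1 ^ 2)) z (EuclideanSpace.single 2 1) = 0 :=
    fderiv_dip_axis hφ1
  have hcurl : curl (fun z => cross (gradient (fun y : EuclideanSpace ℝ (Fin 3) => y 0 * φ (y 0 ^ 2 + y 1 ^ 2)) z)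
      (EuclideanSpace.single 2 1)) y = (y 0 * g (y 0 ^ 2 + y 1 ^ 2)) • EuclideanSpace.single 2 1 := by
    rw [curl_streamField (contDiff_dip hφ2) hax y, laplacian_dip hφ2 y, hg]
    congr 1; ring
  rw [hΨ, hcurl, colForceVort_dip hφC hB0 hB1 hB2 g hg y, smul_smul]
  congr 1
  -- the scalar identity: `y₀`-part `= (γ/2) y₀ g`, `y₁`-part `= 0`
  have hq := hgE (y 0 ^ 2 + y 1 ^ 2)
  have hq' : deriv g (y 0 ^ 2 + y 1 ^ 2) = -(γ ^ 2 / 4) * Real.exp (-(γ * (y 0 ^ 2 + y 1 ^ 2) / 4)) := by rw [hg']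
  have hq'' : deriv (deriv g) (y 0 ^ 2 + y 1 ^ 2) = (γ ^ 3 / 16) * Real.exp (-(γ * (y 0 ^ 2 + y 1 ^ 2) / 4)) := by rw [hg'']
  have hφq : φ (y 0 ^ 2 + y 1 ^ 2) = burgersPhi (γ * (y 0 ^ 2 + y 1 ^ 2) / 4) := rfl
  rw [hq, hq', hq'', hφq]
  ring

end Summit.NavierStokesRegularity.NavierStokesRegularity.Theorems.DefectColumnGate

end
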